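import Literature.Geometry.Kaehler.ComplexTorusAbelianSurfaceQuaternionMultiplicationHodgeLieAlgebraDimension
import HarnessLib

/-!
# A SIMPLE abelian SURFACE with PICARD NUMBER `ρ(X) = 3`: `Hg(X) = S(X)` for every polarisation,
# `dim Hg(X) = dim_ℝ 𝔥𝔤_ℝ = 3`, `(dim 𝔨, dim 𝔭) = (1, 2)`, and `ℬ•(Xⁿ) = 𝒟•(Xⁿ)` for every `n`
# — the polarisation-free currency of Moonen–Zarhin 1999 (2.2), Type II(1)

Layer `Literature/Geometry/Kaehler`, namespace `Literature.Geometry.Kaehler.ComplexTorus`; lane `lit-hodgefound`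
(Track 2 foundations library), Layer A4; prover seat `lit-hodgefound-p17` (generation 48), self-proposed row g48-#5.
g48-#1 (`ComplexTorusAbelianSurfaceQuaternionMultiplicationHodgeEqLefschetz`) and g48-#4
(`ComplexTorusAbelianSurfaceQuaternionMultiplicationHodgeLieAlgebraDimension`) are stated for a simple polarised surface
whose pair `(End⁰(X), ′)` is of Albert type II for the Rosati involution `′` of a CHOSEN polarisation (`IsAlbertTypeII
(centerField Ψ hX) (endAlgRat Ψ) (rosatiEnd Ψ …)`).  The tree's reading of Lange's table
(`IsSimple.finrank_neronSeveriGroup_eq_three_iff_of_finrank_eq_two`: for a simple abelian surface, `ρ(X) = 3 ⟺` type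
II, for ANY polarisation) turns them into statements about the torus alone, in the `IsAbelianVariety` currency: a simple
abelian surface with `ρ(X) = rk NS(X) = 3` has quaternion multiplication, hence `Hg(X) = S(X)` (`= Lf(X)`) for every
polarisation, `dim Hg(X) = 3`, `(dim 𝔨, dim 𝔭) = (1, 2)` and is stably nondegenerate.

THEOREMS ONLY (no definition, no instance, no notation, no named fact; D-0026, net debt 0); nothing restated.

## Sources, VERBATIM (held copies; `p0NNN Lnn` = chunk file and line of the materialised text)

* H. Lange, *Abelian Varieties over the Complex Numbers* (2023), §2.6.1 Proposition (table: type II, `ρ = 3e`) and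
  §5.1.5 Exercise (2)(b) (the endomorphism algebras of simple abelian surfaces; consumed through the tree's
  `IsSimple.finrank_neronSeveriGroup_eq_three_iff_of_finrank_eq_two`).
* K. Hulek, R. Laface, *On the Picard numbers of abelian varieties*, Ann. Sc. Norm. Super. Pisa (5) 19 (2019), held
  `paper:arxiv-1703.05882`, §3 (p0011 L39) «For type II-III, the endomorphism algebra is a quaternion algebra `F` over a
  totally real number field `K`. In this case, the Picard number is `ρ = 3e` for type II and `ρ = e` for type III, where
  `e := [K:ℚ]`»; §1 (p0003) «a very general abelian surface has `ρ = 1`, whereas Picard numbers from 2 to 4 can be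
  realized by taking a product `E₁ × E₂` of two elliptic curves».
* B. Moonen, Yu. G. Zarhin, *Hodge classes on abelian varieties of low dimension*, Math. Ann. 315 (1999), held
  `paper:arxiv-math_9901113` (no statement numbers in the held TeX; «(2.2)» = the `g = 2` list of §2), (2.2) `g = 2`
  (p0005 L69–L73) «Type II(1): `D = End⁰(X)` is a quaternion algebra over `ℚ`, split at `∞`. […] Then `Hg(X)` is the
  algebraic group `U_{D^opp}`»; §3 (p0008 L107–L111) «for every complex abelian variety `X` of dimension `≤ 3` we have
  `Hg(X) = Sp_D(V,φ)` and condition (D) […] is satisfied» (condition (D), §1 p0004 L61–L66: «`ℬ•(Xⁿ) = 𝒟•(Xⁿ)` for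
  all `n`»).
* F. Fité, K. S. Kedlaya, V. Rotger, A. V. Sutherland (2012), held `paper:arxiv-1110.6638`, §4.2 (p0014 L65–L70, L78–L82)
  «(**E**) `M₂(ℝ)`, which occurs when […] `A_K` is simple and `End(A_K)` is an order in a division quaternion algebra over
  `ℚ`», «**E**: `SU(2)`».
* B. B. Gordon, *A survey of the Hodge conjecture for abelian varieties*, Thm. 7.5; J. S. Milne, *Lefschetz classes on
  abelian varieties* (1999), §2 table (type II: connected) and §4 Prop. 4.8.

## Contents (all for `X = E/Ψ(ℤ^κ)` a SIMPLE abelian surface with `finrank ℤ (neronSeveriGroup Ψ) = 3`)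

* `IsSimple.isAlbertTypeII_of_finrank_neronSeveriGroup_eq_three` (dot-free restatement of the `←` direction of the
  tree's iff, for use with `obtain`), **`IsSimple.hodgeGroup_eq_lefschetzGroup_of_finrank_neronSeveriGroup_eq_three`**
  (`Hg(X)(ℝ) = S(X)(ℝ)` for EVERY polarisation), `…_eq_lefschetzIdentity_…`;
* **`IsAbelianVariety.forall_divisorClasses_powPeriod_eq_hodgeClasses_of_isSimple_of_finrank_neronSeveriGroup_eq_three`**
  (`ℬ•(Xⁿ) = 𝒟•(Xⁿ)` for every `n`);
* **`IsAbelianVariety.finrank_hodgeGroupLie_eq_three_of_isSimple_of_finrank_neronSeveriGroup_eq_three`** (`dim_ℝ 𝔥𝔤_ℝ = 3`),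
  `…finrank_hodgeGroupComplexLie_eq_three…`, `…zdim_hodgeGroupC_eq_three…` (`dim Hg(X) = 3`),
  `…finrank_hodgeIsotropyLie_eq_one…` (`(dim 𝔨, dim 𝔭) = (1, 2)`).
-/

noncomputable section

open scoped Matrix
open Module Matrix NormedSpace NumberField
open Literature.RingTheory.CentralSimple (IsAlbertTypeII)
open Literature.NumberTheory.Automorphic (IsZConnected)

namespace Literature.Geometry.Kaehler

namespace ComplexTorus

section PicardNumberThree

variable {κ : Type} [Fintype κ] [DecidableEq κ] [Nonempty κ] {E : Type} [NormedAddCommGroup E] [NormedSpace ℂ E]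
  [FiniteDimensional ℂ E] {Ψ : (κ → ℝ) ≃L[ℝ] E} {η : E [⋀^Fin 2]→L[ℝ] ℝ} {G : Matrix κ κ ℚ}

/-- **`ρ(X) = 3 ⟹` Albert type II, for every polarisation** of a simple abelian surface («`ρ = 3e` for type II»,
`e = 1`; the `←`-free form of the tree's `IsSimple.finrank_neronSeveriGroup_eq_three_iff_of_finrank_eq_two`).
[cite: Lange2023AbelianVarietiesComplex, §2.6.1 Proposition (table, `ρ = 3e`) with §5.1.5 Exercise (2)(b)]
[cite: HulekLaface2019PicardNumbersAV, §3 («the Picard number is `ρ = 3e` for type II and `ρ = e` for type III»)] -/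
theorem IsSimple.isAlbertTypeII_of_finrank_neronSeveriGroup_eq_three (hX : IsSimple Ψ) (hη : IsRiemannForm Ψ η)
    (hG : G.map (Rat.cast : ℚ → ℝ) = latticeGram Ψ η) (h2 : finrank ℂ E = 2)
    (hρ : finrank ℤ (neronSeveriGroup Ψ) = 3) :
    IsAlbertTypeII (centerField Ψ hX) (endAlgRat Ψ) (rosatiEnd Ψ hη.1 hη.2.2 hG) :=
  (hX.finrank_neronSeveriGroup_eq_three_iff_of_finrank_eq_two hη hG h2).1 hρ

/-- **`Hg(X)(ℝ) = Lf(X)(ℝ)` for a simple abelian surface with `ρ(X) = 3`**, for every polarisation and every rational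
Gram matrix `G` of it. [cite: MoonenZarhin1999LowDim, §2 (2.2) `g = 2` («Type II(1) … `Hg(X)` is the algebraic group `U_{D^opp}`»)]
[cite: Lange2023AbelianVarietiesComplex, §2.6.1 Proposition (table, `ρ = 3e`)] -/
theorem IsSimple.hodgeGroup_eq_lefschetzIdentity_of_finrank_neronSeveriGroup_eq_three (hX : IsSimple Ψ)
    (hη : IsRiemannForm Ψ η) (hG : G.map (Rat.cast : ℚ → ℝ) = latticeGram Ψ η) (h2 : finrank ℂ E = 2)
    (hρ : finrank ℤ (neronSeveriGroup Ψ) = 3) : hodgeGroup Ψ = lefschetzIdentity Ψ G :=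
  hX.hodgeGroup_eq_lefschetzIdentity_of_isAlbertTypeII_of_finrank_eq_two hη hG
    (hX.isAlbertTypeII_of_finrank_neronSeveriGroup_eq_three hη hG h2 hρ) h2

/-- **`Hg(X)(ℝ) = S(X)(ℝ)` for a simple abelian surface with `ρ(X) = 3`, for EVERY polarisation `η`** (the Lefschetz
group `S(X)` of a type II surface is connected). [cite: MoonenZarhin1999LowDim, §2 (2.2) `g = 2` («Type II(1)») and §3 (p0008 L107–L111: «`Hg(X) = Sp_D(V,φ)`»)]
[cite: Milne1999LefschetzClasses, §2 Summary table (type II: connected) and §4 Prop. 4.8] -/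
theorem IsSimple.hodgeGroup_eq_lefschetzGroup_of_finrank_neronSeveriGroup_eq_three (hX : IsSimple Ψ)
    (hη : IsRiemannForm Ψ η) (h2 : finrank ℂ E = 2) (hρ : finrank ℤ (neronSeveriGroup Ψ) = 3) :
    hodgeGroup Ψ = lefschetzGroup Ψ η := by
  obtain ⟨G, hG⟩ := hη.exists_ratMatrix_latticeGram
  exact hX.hodgeGroup_eq_lefschetzGroup_of_isAlbertTypeII_of_finrank_eq_two hη hG
    (hX.isAlbertTypeII_of_finrank_neronSeveriGroup_eq_three hη hG h2 hρ) h2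

/-- **A SIMPLE ABELIAN SURFACE WITH `ρ(X) = 3` IS STABLY NONDEGENERATE: `ℬ•(Xⁿ) = 𝒟•(Xⁿ)` for every `n`** — on every
power `Xᵏ` and in every codimension `p` the Hodge classes are generated by divisor classes (hence algebraic); the
polarisation-free form of Moonen–Zarhin's condition (D) for Type II(1). [cite: MoonenZarhin1999LowDim, §3 (p0008 L107–L111: «for every complex abelian variety `X` of dimension `≤ 3` … condition (D) … is satisfied») and §2 (2.2) `g = 2` («Type II(1)»)]
[cite: Lange2023AbelianVarietiesComplex, §2.6.1 Proposition (table, `ρ = 3e`)] [cite: Gordon1999HodgeAVSurvey, Thm. 7.5 (1) ⟺ (2)] -/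
theorem IsAbelianVariety.forall_divisorClasses_powPeriod_eq_hodgeClasses_of_isSimple_of_finrank_neronSeveriGroup_eq_three
    (hA : IsAbelianVariety Ψ) (hX : IsSimple Ψ) (h2 : finrank ℂ E = 2) (hρ : finrank ℤ (neronSeveriGroup Ψ) = 3) :
    ∀ k p : ℕ, divisorClasses (powPeriod Ψ k) p = hodgeClasses (powPeriod Ψ k) p := by
  obtain ⟨η, hη⟩ := hA
  obtain ⟨G, hG⟩ := hη.exists_ratMatrix_latticeGram
  exact hX.forall_divisorClasses_powPeriod_eq_hodgeClasses_of_isAlbertTypeII_of_finrank_eq_two hη hG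
    (hX.isAlbertTypeII_of_finrank_neronSeveriGroup_eq_three hη hG h2 hρ) h2

/-- **`dim_ℝ 𝔥𝔤_ℝ = 3` for a simple abelian surface with `ρ(X) = 3`** (`𝔥𝔤_ℝ ≅ 𝔰𝔩₂(ℝ)`; Sato–Tate type **E** ↔ `SU(2)`).
[cite: FiteEtAl2012, §4.2 (type **E**: «`A_K` is simple and `End(A_K)` is an order in a division quaternion algebra over `ℚ`» ↔ `SU(2)`)]
[cite: MoonenZarhin1999LowDim, §2 (2.2) `g = 2` («Type II(1)»)] [cite: Lange2023AbelianVarietiesComplex, §2.6.1 Proposition (table, `ρ = 3e`)] -/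
theorem IsAbelianVariety.finrank_hodgeGroupLie_eq_three_of_isSimple_of_finrank_neronSeveriGroup_eq_three
    (hA : IsAbelianVariety Ψ) (hX : IsSimple Ψ) (h2 : finrank ℂ E = 2) (hρ : finrank ℤ (neronSeveriGroup Ψ) = 3) :
    finrank ℝ (hodgeGroupLie Ψ) = 3 := by
  obtain ⟨η, hη⟩ := hA
  obtain ⟨G, hG⟩ := hη.exists_ratMatrix_latticeGram
  exact hX.finrank_hodgeGroupLie_eq_three_of_isAlbertTypeII_of_finrank_eq_two hη hG
    (hX.isAlbertTypeII_of_finrank_neronSeveriGroup_eq_three hη hG h2 hρ) h2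

/-- **`dim_ℂ 𝔤 = 3`** (`𝔤 = Lie Hg(X)(ℂ) ≅ 𝔰𝔩₂(ℂ)`) for a simple abelian surface with `ρ(X) = 3`.
[cite: MoonenZarhin1999LowDim, §2 (2.2) `g = 2` («Type II(1)») and §3 proof of (3.3)] [cite: Lange2023AbelianVarietiesComplex, §2.6.1 Proposition (table, `ρ = 3e`)] -/
theorem IsAbelianVariety.finrank_hodgeGroupComplexLie_eq_three_of_isSimple_of_finrank_neronSeveriGroup_eq_three
    (hA : IsAbelianVariety Ψ) (hX : IsSimple Ψ) (h2 : finrank ℂ E = 2) (hρ : finrank ℤ (neronSeveriGroup Ψ) = 3) :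
    finrank ℂ (hodgeGroupComplexLie Ψ) = 3 := by
  rw [finrank_hodgeGroupComplexLie_eq_finrank_hodgeGroupLie Ψ]
  exact hA.finrank_hodgeGroupLie_eq_three_of_isSimple_of_finrank_neronSeveriGroup_eq_three hX h2 hρ

/-- **`dim Hg(X) = 3`** (the trunk's `zdim` of the connected algebraic group `Hg(X)(ℂ) ≤ GL(V_ℂ)`) for a simple abelian
surface with `ρ(X) = 3`. [cite: MoonenZarhin1999LowDim, §2 (2.2) `g = 2` («`Hg(X)` is the algebraic group `U_{D^opp}`»)]
[cite: GoodmanWallachGTM255, §1.4.4 Thm. 1.4.10] -/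
theorem IsAbelianVariety.zdim_hodgeGroupC_eq_three_of_isSimple_of_finrank_neronSeveriGroup_eq_three
    (hA : IsAbelianVariety Ψ) (hX : IsSimple Ψ) (h2 : finrank ℂ E = 2) (hρ : finrank ℤ (neronSeveriGroup Ψ) = 3) :
    (isZConnected_map_toGL_hodgeGroupC Ψ).zdim = 3 :=
  (zdim_hodgeGroupC_eq_iff_finrank_hodgeGroupLie_eq Ψ).2
    (hA.finrank_hodgeGroupLie_eq_three_of_isSimple_of_finrank_neronSeveriGroup_eq_three hX h2 hρ)

/-- **`(dim 𝔨, dim 𝔭) = (1, 2)`** for a simple abelian surface with `ρ(X) = 3` (`𝔥𝔤_ℝ ≅ 𝔰𝔩₂(ℝ) = 𝔰𝔬(2) ⊕ 𝔭`).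
[cite: FiteEtAl2012, §4.2 (type **E** ↔ `SU(2)`) and §3.2 Lemma 3.7] [cite: Lange2023AbelianVarietiesComplex, §2.6.1 Proposition (table, `ρ = 3e`)] -/
theorem IsAbelianVariety.finrank_hodgeIsotropyLie_eq_one_of_isSimple_of_finrank_neronSeveriGroup_eq_three
    (hA : IsAbelianVariety Ψ) (hX : IsSimple Ψ) (h2 : finrank ℂ E = 2) (hρ : finrank ℤ (neronSeveriGroup Ψ) = 3) :
    finrank ℝ (hodgeIsotropyLie Ψ) = 1 ∧ finrank ℝ (hodgeCartanP Ψ) = 2 := by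
  obtain ⟨η, hη⟩ := hA
  exact (hη.finrank_hodgeGroupLie_eq_three_iff_of_finrank_eq_two h2).1
    (IsAbelianVariety.finrank_hodgeGroupLie_eq_three_of_isSimple_of_finrank_neronSeveriGroup_eq_three ⟨η, hη⟩ hX h2 hρ)

end PicardNumberThree

end ComplexTorus

end Literature.Geometry.Kaehler
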